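import Literature.AlgebraicGeometry.Resolution.AlterationsProofs
import Literature.AlgebraicGeometry.Dimension.PointDimension
import Literature.AlgebraicGeometry.Motives.BettiCycleClassProofs
import Literature.AlgebraicGeometry.Motives.AbelianVarietyIsogenyProofs
import Mathlib.AlgebraicGeometry.FunctionField
import HarnessLib

/-!
# Dimension bookkeeping for varieties and alterations (de Jong 1996, 2.20)

Topic: `Literature/AlgebraicGeometry/Resolution`. Fourth companion to `Alterations.lean` on the
way to de Jong's theorem (Thm. 4.1), whose printed proof is an induction on `d = dim X` in which
the pair `(X, Z)` is repeatedly replaced by `(X', φ⁻¹ Z)` along alterations `φ : X' → X` (4.4):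
this needs `dim X' = dim X`, which de Jong records in 2.20 — "for some non-empty open `U ⊂ S`,
the morphism `φ⁻¹(U) → U` is finite. (This last condition is equivalent to the condition
`dim S = dim S'`, at least if these are finite.)" — and which in turn rests on the invariance of
the dimension of a variety under passing to a non-empty open subscheme (Görtz–Wedhorn I,
Thm. 5.22 (3)). All statements are proved.

## Content

* `topologicalKrullDim_eq_ringKrullDim_of_isAffineOpen` — for an integral scheme `X` locally
  of finite type over a field and a non-empty affine open `U`, `dim X = dim Γ(X, U)`
  (Görtz–Wedhorn I, Thm. 5.22 (1): both are `trdeg_k K(X)`; here via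
  `dim X = height η` (`Literature.AlgebraicGeometry.Motives.Scheme.height_genericPoint`, `BettiCycleClassProofs.lean`) and the
  chart formula `height η = dim Γ(X, U) ⧸ 𝔭_U(η)` of `PointDimension.lean`, `𝔭_U(η) = 0`).
* `topologicalKrullDim_eq_of_isOpenImmersion` — a non-empty open subscheme of such an `X` has
  the same dimension (Görtz–Wedhorn I, Thm. 5.22 (3)).
* `IsAlteration.topologicalKrullDim_eq` — **de Jong 1996, 2.20**: an alteration `φ : X' → X`
  of a variety satisfies `dim X' = dim X` (over the open `U` of finiteness, `φ⁻¹(U) → U` is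
  finite and surjective, so `dim φ⁻¹(U) = dim U`, `Literature.AlgebraicGeometry.Motives.Scheme.topologicalKrullDim_eq_of_isFinite_of_surjective`).

## Sources

* A. J. de Jong, *Smoothness, semi-stability and alterations*, Publ. Math. IHÉS 83 (1996), 2.20
  (p. 61).
* U. Görtz, T. Wedhorn, *Algebraic Geometry I: Schemes*, 2nd ed. (2020), Thm. 5.22 (1), (3)
  (pp. 158–159), Prop. 12.12.
-/

noncomputable section

open CategoryTheory AlgebraicGeometry TopologicalSpace Topology Order

namespace Literature.AlgebraicGeometry.Resolution

universe u

variable {k : Type u} [Field k]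

/-- **`dim X = dim Γ(X, U)` for a non-empty affine open `U` of an integral scheme locally of
finite type over a field** (Görtz–Wedhorn I, Thm. 5.22 (1)): the dimension is the height of the
generic point `η`, which any affine chart computes as `dim Γ(X, U) ⧸ 𝔭_U(η)`
(`Literature.AlgebraicGeometry.Dimension.Scheme.height_eq_ringKrullDim_quotient_primeIdealOf`), and `𝔭_U(η) = 0`.
[cite: GortzWedhorn2020, Thm. 5.22 (1)] -/
theorem topologicalKrullDim_eq_ringKrullDim_of_isAffineOpen {X : Scheme.{u}} [IsIntegral X]
    (f : X ⟶ Spec (.of k)) [LocallyOfFiniteType f] {U : X.Opens} (hU : IsAffineOpen U)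
    (hne : (U : Set X).Nonempty) : topologicalKrullDim X = ringKrullDim Γ(X, U) := by
  haveI : Nonempty U := hne.to_subtype
  have hη : genericPoint X ∈ U :=
    ((genericPoint_spec X).mem_open_set_iff U.isOpen).mpr (by simpa using hne)
  rw [← Literature.AlgebraicGeometry.Motives.Scheme.height_genericPoint X,
    Literature.AlgebraicGeometry.Dimension.Scheme.height_eq_ringKrullDim_quotient_primeIdealOf f hU hη]
  have hbot : (hU.primeIdealOf ⟨genericPoint X, hη⟩).asIdeal = ⊥ := by
    rw [hU.primeIdealOf_genericPoint, genericPoint_eq_bot_of_affine]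
    rfl
  rw [hbot]
  exact ringKrullDim_eq_of_ringEquiv (RingEquiv.quotientBot _)

/-- **A non-empty open subscheme of an integral scheme locally of finite type over a field has
the same dimension** (Görtz–Wedhorn I, Thm. 5.22 (3)): compute both dimensions on a non-empty
affine open of the smaller one. [cite: GortzWedhorn2020, Thm. 5.22 (3)] -/
theorem topologicalKrullDim_eq_of_isOpenImmersion {U X : Scheme.{u}} [IsIntegral X]
    (f : X ⟶ Spec (.of k)) [LocallyOfFiniteType f] (i : U ⟶ X) [IsOpenImmersion i]
    [Nonempty U] : topologicalKrullDim U = topologicalKrullDim X := by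
  haveI : IsIntegral U := isIntegral_of_isOpenImmersion i
  -- a non-empty affine open `W` of `U` and its image `i(W)`, an affine open of `X`
  obtain ⟨_, ⟨W, hW, rfl⟩, hηW, -⟩ := U.isBasis_affineOpens.exists_subset_of_mem_open
    (Set.mem_univ (genericPoint U)) isOpen_univ
  have hWne : (W : Set U).Nonempty := ⟨_, hηW⟩
  have hW' : IsAffineOpen (i ''ᵁ W) := hW.image_of_isOpenImmersion i
  have hW'ne : ((i ''ᵁ W : X.Opens) : Set X).Nonempty := ⟨i (genericPoint U), _, hηW, rfl⟩
  rw [topologicalKrullDim_eq_ringKrullDim_of_isAffineOpen (i ≫ f) hW hWne,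
    topologicalKrullDim_eq_ringKrullDim_of_isAffineOpen f hW' hW'ne]
  exact (ringKrullDim_eq_of_ringEquiv (i.appIso W).commRingCatIsoToRingEquiv).symm

/-- The special case of an open `U ⊆ X`. [cite: GortzWedhorn2020, Thm. 5.22 (3)] -/
theorem topologicalKrullDim_opens_eq {X : Scheme.{u}} [IsIntegral X] (f : X ⟶ Spec (.of k))
    [LocallyOfFiniteType f] (U : X.Opens) (hU : (U : Set X).Nonempty) :
    topologicalKrullDim U = topologicalKrullDim X := by
  haveI : Nonempty U := hU.to_subtype
  exact topologicalKrullDim_eq_of_isOpenImmersion f U.ι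

/-- **de Jong 1996, 2.20: an alteration does not change the dimension.** If `φ : X' → X` is an
alteration of a variety `X` over `k` then `dim X' = dim X`: over the non-empty open `U ⊆ X` of
finiteness, `φ⁻¹(U) → U` is finite and (alterations being surjective) surjective, so
`dim φ⁻¹(U) = dim U` (Stacks 0ECG, `Literature.AlgebraicGeometry.Motives.Scheme.topologicalKrullDim_eq_of_isFinite_of_surjective`),
and `dim U = dim X`, `dim φ⁻¹(U) = dim X'` by `topologicalKrullDim_eq_of_isOpenImmersion`
(`X'` is integral and, `φ` being proper, of finite type over `k`).
[cite: DeJong1996, 2.20, p. 61] -/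
theorem IsAlteration.topologicalKrullDim_eq {X' X : Scheme.{u}} [IsIntegral X]
    (f : X ⟶ Spec (.of k)) [LocallyOfFiniteType f] {φ : X' ⟶ X} (hφ : IsAlteration φ) :
    topologicalKrullDim X' = topologicalKrullDim X := by
  haveI := hφ.isIntegral
  haveI := hφ.isProper
  haveI : Surjective φ := hφ.surjective
  obtain ⟨U, hU, hfin⟩ := hφ.exists_isFinite
  haveI := hfin
  haveI : Surjective (φ ∣_ U) := IsZariskiLocalAtTarget.restrict ‹Surjective φ› U
  have hU' : ((φ ⁻¹ᵁ U : X'.Opens) : Set X').Nonempty := by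
    obtain ⟨x, hx⟩ := hU
    obtain ⟨x', rfl⟩ := φ.surjective x
    exact ⟨x', hx⟩
  rw [← topologicalKrullDim_opens_eq (φ ≫ f) (φ ⁻¹ᵁ U) hU', ← topologicalKrullDim_opens_eq f U hU]
  exact Literature.AlgebraicGeometry.Motives.Scheme.topologicalKrullDim_eq_of_isFinite_of_surjective (φ ∣_ U)

end Literature.AlgebraicGeometry.Resolution

end
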